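import Summits.QuantumFields.YangMills.Theorems.LuscherReductionRunningReductionKTDoorFaithful
import Summits.QuantumFields.YangMills.Theorems.LuscherReductionUpperTraceDoorConverse
import HarnessLib

/-!
# Crux RED `RunningReduction` (stmt-QuantumFields-19978) and its children: WHAT THE TT SPLIT OVERSHOOTS BY —
# `(TwistedTraceScaling ∧ DressedRitz) ↔ (RunningReduction ∧ FemtoWeyl)`; given RED, the child `TwistedTraceScaling` IS the femto Weyl bound

Route `LuscherReduction` (rung R2b1).  RED (stmt-QuantumFields-19978) is split (route rev 11/12) along the TT door of skeleton «KTR» r8 into the closed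
children `TraceFormula` ∕ `OneSiteTail`, and the open cruxes `TwistedTraceScaling` (stmt-QuantumFields-20203, the RG trace statement) and `DressedRitz`
(stmt-QuantumFields-20205), glue `TraceDoorGlue` ✓.  The KT door is LOSSLESS (`KTCoarseHandover.runningReduction_iff_coarseHandoverUpper_two_and_dressedRitz`,
p794569).  THIS FILE measures the TT door: its two open children are jointly equivalent to RED PLUS exactly one extra `L`-uniform statement, the femto Weyl
bound `UTD.FemtoWeyl` (`∀ s₀ > 0, UTD.FemtoWeylAt s₀`: deep in the window `Z_phys(L, β, ⌈s₀L/Λ⌉) ≤ C·λ_0^{⌈s₀L/Λ⌉}` — no accumulation of zero-flux levels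
below energy `O(Λ/L)` beyond a Laplace-summable tower; the full-theory twin of the closed child `OneSiteTail`):

* ★ `twistedTraceScaling_of_runningReduction_of_femtoWeyl : RED → FemtoWeyl → TwistedTraceScaling` — NO `DressedRitz` hypothesis: RED ⟹ `CoarseLevels`
  (`KTCoarseHandover.coarseLevels_of_runningReduction`, p794569, through N34 and the closed crux ONE), `CoarseLevels ∧ FemtoWeyl ⟹ UpperTraceLaw`
  (`UTD.upperTraceLaw_of_coarseLevels`), RED ⟹ `DressedRitz` (`KTRCalibration.dressedRitz_of_runningReduction_unconditional`), and the converse door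
  `UTD.twistedTraceScaling_of_upperTraceLaw'` (`OneSiteTail` closed);
* ★★ `twistedTraceScaling_iff_femtoWeyl_of_runningReduction : RED → (TwistedTraceScaling ↔ FemtoWeyl)` (`←` above; `→` = `UTD.femtoWeyl_of_twistedTraceScaling'`,
  unconditional) — GIVEN THE PARENT, the child 20203 is exactly the femto Weyl bound;
* ★★★ `twistedTraceScaling_and_dressedRitz_iff_runningReduction_and_femtoWeyl : (TwistedTraceScaling ∧ DressedRitz) ↔ (RED ∧ FemtoWeyl)` — unconditional
  (`→`: glue `TraceDoor.runningReduction_of_twistedTraceScaling_dressedRitz` + `UTD.femtoWeyl_of_twistedTraceScaling'`; `←`: the first bullet + RED ⟹ `DressedRitz`).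
  Planner-facing reading: the TT split {20203, 20205} of RED is lossy by EXACTLY `FemtoWeyl` (a `k`-UNIFORM statement the level-by-level crux RED does not
  contain), whereas the KT split {3a′, 20205} is lossless (p794569); 20203 ⟹ 3a′ (p794134).

HONEST FRAMING: implications among OPEN statements on the femto rung R2b1 of the CONDITIONAL Lüscher reduction route; RED, `TwistedTraceScaling`,
`DressedRitz`, 3a′ and `FemtoWeyl` all stay OPEN; nothing here bears on infinite volume, the continuum limit, a mass gap or Clay.  Sorry-free, no
definitions, no named-fact hypotheses (the hypotheses are the route's own decls and the tree predicate `UTD.FemtoWeylAt`).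
-/

set_option autoImplicit false

noncomputable section

open MeasureTheory Filter Topology Real
open Literature.MathematicalPhysics.QuantumFieldTheory hiding SU2
open Summit.QuantumFields.YangMills.Theses.LuscherReduction (RunningReduction TwistedTraceScaling DressedRitz)

namespace Summit.QuantumFields.YangMills.Theorems.FemtoTransferGap.KTCoarseHandover

open Summit.QuantumFields.YangMills.Theorems.FemtoTransferGap

/-- ★ **`RunningReduction → FemtoWeyl → TwistedTraceScaling`, with NO `DressedRitz` hypothesis.**  RED gives the coarse two-sided Lüscher law
(`coarseLevels_of_runningReduction`, p794569: N34 via `femtoLevels_of_reduction` and the closed crux ONE); with the femto Weyl bound this is the upper trace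
law (`UTD.upperTraceLaw_of_coarseLevels`); RED also gives the dressed Ritz family (`KTRCalibration.dressedRitz_of_runningReduction_unconditional`: exact
zero-flux eigenfunctions); the converse door `UTD.twistedTraceScaling_of_upperTraceLaw'` (`OneSiteTail` closed) concludes. [cite: Luscher1983, §3]
[cite: LuscherMunster1984, §2] -/
theorem twistedTraceScaling_of_runningReduction_of_femtoWeyl (hRED : RunningReduction)
    (hWeyl : ∀ s0 : ℝ, 0 < s0 → UTD.FemtoWeylAt s0) : TwistedTraceScaling := by
  have hDR : DressedRitz := by
    unfold Summit.QuantumFields.YangMills.Theses.LuscherReduction.DressedRitz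
    exact KTRCalibration.dressedRitz_of_runningReduction_unconditional hRED
  exact UTD.twistedTraceScaling_of_upperTraceLaw'
    (UTD.upperTraceLaw_of_coarseLevels (coarseLevels_of_runningReduction hRED) hWeyl) hDR

/-- ★★ **Given the parent crux RED, the child `TwistedTraceScaling` (stmt-QuantumFields-20203) IS the femto Weyl bound**:
`RunningReduction → (TwistedTraceScaling ↔ FemtoWeyl)` (`→`: `UTD.femtoWeyl_of_twistedTraceScaling'`, unconditional; `←`:
`twistedTraceScaling_of_runningReduction_of_femtoWeyl`). [cite: Luscher1983, §3] -/
theorem twistedTraceScaling_iff_femtoWeyl_of_runningReduction (hRED : RunningReduction) :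
    TwistedTraceScaling ↔ (∀ s0 : ℝ, 0 < s0 → UTD.FemtoWeylAt s0) :=
  ⟨UTD.femtoWeyl_of_twistedTraceScaling', twistedTraceScaling_of_runningReduction_of_femtoWeyl hRED⟩

/-- ★★★ **What the TT split of RED overshoots by: `(TwistedTraceScaling ∧ DressedRitz) ↔ (RunningReduction ∧ FemtoWeyl)`**, unconditionally.  `→`: the glue
`TraceDoor.runningReduction_of_twistedTraceScaling_dressedRitz` (route item `TraceDoorGlue` with the closed children fed in) and `UTD.femtoWeyl_of_twistedTraceScaling'`;
`←`: `twistedTraceScaling_of_runningReduction_of_femtoWeyl` and RED ⟹ `DressedRitz` (`KTRCalibration.dressedRitz_of_runningReduction_unconditional`).  So the two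
open children {20203, 20205} are jointly equivalent to the parent 19978 plus exactly the `k`-uniform femto Weyl bound — compare the lossless KT split
`runningReduction_iff_coarseHandoverUpper_two_and_dressedRitz` (p794569). [cite: Luscher1983, §3] [cite: LuscherMunster1984, §2] [cite: Kato1949, Lemma 2, Thm 1] -/
theorem twistedTraceScaling_and_dressedRitz_iff_runningReduction_and_femtoWeyl :
    (TwistedTraceScaling ∧ DressedRitz) ↔ (RunningReduction ∧ ∀ s0 : ℝ, 0 < s0 → UTD.FemtoWeylAt s0) := by
  constructor
  · rintro ⟨hTS, hDR⟩
    exact ⟨TraceDoor.runningReduction_of_twistedTraceScaling_dressedRitz hTS hDR, UTD.femtoWeyl_of_twistedTraceScaling' hTS⟩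
  · rintro ⟨hRED, hWeyl⟩
    refine ⟨twistedTraceScaling_of_runningReduction_of_femtoWeyl hRED hWeyl, ?_⟩
    unfold Summit.QuantumFields.YangMills.Theses.LuscherReduction.DressedRitz
    exact KTRCalibration.dressedRitz_of_runningReduction_unconditional hRED

end Summit.QuantumFields.YangMills.Theorems.FemtoTransferGap.KTCoarseHandover

end
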